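import Summits.AnomalousDissipation.AnomalousDissipation.Theorems.LaminarNeverLoud.Negative.PowerBudget

/-!
# Negative knowledge for the crux `LaminarNeverLoud` (stmt-AnomalousDissipation-2988): VII, scale covariance

Certified copy of §6 of the cdisprove work file `Cruxes/LaminarNeverLoud/Disproof.lean`.  Supports
stmt-AnomalousDissipation-2988.  SCALE COVARIANCE (Grashof form) of the crux: the Galerkin field is homogeneous of
bidegree `(1,2)` (`galerkinRHS_scale`: `V(tν, t²ĝ)(tc) = t² V(ν, ĝ)(c)`), so the steady variety, its laminar part, the
energy, the dissipation and the force vector transform by `V(t²ĝ) = t • V(ĝ)` (`steadySet_scale`), `laminarSet_scale`,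
`energy ↦ t²`, `dissipation ↦ t³`, `forceCoeff_smul`; whence `admissible_scale_iff`:
`ν₀ ∈ admissibleSet f E ε ↔ tν₀ ∈ admissibleSet (t²f) (t²E) (t³ε)` for `t > 0`.  The crux may be normalised at will
(e.g. `‖f‖₂ = 1`); its only scale-free budget is `β = ε²/(E∫‖f‖²)`; rescaling a loud moderate-viscosity laminar state
down the viscosities multiplies its dissipation by `t³` — symmetry alone gives no counterexample.  No new definitions.
-/

noncomputable section

namespace Summit.AnomalousDissipation.AnomalousDissipation.Theorems.LaminarNeverLoud.Negative

open MeasureTheory Set Filter Topology UnitAddTorus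
open scoped InnerProductSpace
open Literature.Analysis.FluidPDE Literature.Analysis.FluidPDE.Torus
open Literature.Analysis.FunctionSpaces Literature.Analysis.FunctionSpaces.Torus
-- (fullbuild repair 2026-08-16) `Theses.MirrorVariety.LaminarNeverLoud` was dropped from the route at rev 14; the
-- crux's statement now lives as `Negative.LaminarNeverLoud` in `PowerBudget.lean` (this namespace), so the former
-- `open … (LaminarNeverLoud)` line is gone.  No declaration of this file names the crux.

variable {d : Type*} [Fintype d] [DecidableEq d]

/-! ## §6 Scale covariance (Grashof form): `(c, ν, ĝ) ↦ (t c, t ν, t² ĝ)`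

The Galerkin field is homogeneous of bidegree `(1, 2)`: `V(tν, t²ĝ)(tc) = t² V(ν, ĝ)(c)`.  Hence
`V_N(t²f) = t • V_N(f)` as subsets of `(P_S) × ℝ`, laminar parts correspond, `energy ↦ t²`, `dissipation ↦ t³`,
and admissible thresholds transform by `ν₀ ↦ t ν₀` when `(f, E, ε) ↦ (t²f, t²E, t³ε)` (`admissible_scale_iff`).
READING: the crux may be normalised at will (e.g. `‖f‖₂ = 1`, or `E = 1`); its only scale-free budget is
`β = ε²/(E ∫‖f‖²) ∈ (0, 1]` (power bound, §2), and `ν₀(f, E, ε) = ‖f‖₂^{1/2} · Φ(f/‖f‖₂, E/‖f‖₂, β)`.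
Rescaling one loud moderate-viscosity laminar state down the viscosities multiplies its dissipation by `t³` and
its energy by `t²` — symmetry alone produces no counterexample (compare the Stokes arc, which IS a scaling orbit). -/

section Scaling

open Pointwise

variable {S : Finset (d → ℤ)}

omit [Fintype d] [DecidableEq d] in
/-- Real scalar multiples of coefficient families are complex scalar multiples. [folklore] -/
theorem real_smul_eq_coe_smul_fun (t : ℝ) (C : (d → ℤ) → EuclideanSpace ℂ d) :
    t • C = (t : ℂ) • C := by
  funext l; exact RCLike.real_smul_eq_coe_smul (K := ℂ) t (C l)

omit [DecidableEq d] in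
/-- **Homogeneity of the Galerkin field**: `galerkinRHS S (tν) (t²g) (tc) = t² galerkinRHS S ν g c`. [folklore] -/
theorem galerkinRHS_scale (t ν : ℝ) (g c : ↥S → EuclideanSpace ℂ d) :
    galerkinRHS S (t * ν) ((t ^ 2) • g) (t • c) = (t ^ 2) • galerkinRHS S ν g c := by
  funext k
  have hc : coeffExt S (t • c) = (t : ℂ) • coeffExt S c := by
    rw [coeffExt_smul, real_smul_eq_coe_smul_fun]
  have hg : coeffExt S ((t ^ 2) • g) = ((t : ℂ) ^ 2) • coeffExt S g := by
    rw [coeffExt_smul, real_smul_eq_coe_smul_fun]; push_cast; rfl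
  rw [Pi.smul_apply, galerkinRHS_apply, galerkinRHS_apply, galerkinField_def, galerkinField_def, hc, hg,
    convectionCoeff_smul_left, convectionCoeff_smul_right, Pi.smul_apply, Pi.smul_apply,
    RCLike.real_smul_eq_coe_smul (K := ℂ) (t ^ 2)]
  simp only [leraySym_sub, leraySym_smul, smul_smul, smul_sub, smul_add, smul_neg]
  push_cast
  module

omit [DecidableEq d] in
/-- **The steady variety scales**: `V(t²g) = t • V(g)` in `P_S × ℝ` for `t ≠ 0`. [folklore] -/
theorem steadySet_scale {t : ℝ} (ht : t ≠ 0) (g : ↥S → EuclideanSpace ℂ d) :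
    steadySet S ((t ^ 2) • g) = t • steadySet S g := by
  ext z
  rw [Set.mem_smul_set_iff_inv_smul_mem₀ ht]
  have key := galerkinRHS_scale (S := S) t (t⁻¹ * z.2) g (t⁻¹ • z.1)
  rw [smul_smul, mul_inv_cancel₀ ht, one_smul, ← mul_assoc, mul_inv_cancel₀ ht, one_mul] at key
  show (z.1 ∈ galerkinSubspace S ∧ galerkinRHS S z.2 ((t ^ 2) • g) z.1 = 0) ↔
    ((t⁻¹ • z).1 ∈ galerkinSubspace S ∧ galerkinRHS S (t⁻¹ • z).2 g (t⁻¹ • z).1 = 0)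
  simp only [Prod.smul_fst, Prod.smul_snd, smul_eq_mul]
  constructor
  · rintro ⟨hmem, h0⟩
    refine ⟨Submodule.smul_mem _ _ hmem, ?_⟩
    rw [key] at h0
    exact (smul_eq_zero.1 h0).resolve_left (pow_ne_zero 2 ht)
  · rintro ⟨hmem, h0⟩
    refine ⟨?_, ?_⟩
    · have := Submodule.smul_mem (galerkinSubspace S) t hmem
      rwa [smul_smul, mul_inv_cancel₀ ht, one_smul] at this
    · rw [key, h0, smul_zero]

/-- **Laminar parts scale** (positive factors): `laminarSet (t • V) = t • laminarSet V`. [folklore] -/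
theorem laminarSet_scale {X : Type*} [TopologicalSpace X] [AddCommGroup X] [Module ℝ X]
    [ContinuousConstSMul ℝ X] (V : Set (X × ℝ)) {t : ℝ} (ht : 0 < t) :
    laminarSet (t • V) = t • laminarSet V := by
  set φ : X × ℝ ≃ₜ X × ℝ := Homeomorph.smulOfNeZero t ht.ne' with hφ
  have hφV : t • V = φ '' V := by
    ext z; simp only [Set.mem_smul_set, Set.mem_image]; rfl
  ext z
  rw [Set.mem_smul_set_iff_inv_smul_mem₀ ht.ne']
  constructor
  · intro hz
    -- `z ∈ t • V` (its component is nonempty)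
    obtain ⟨z₀, hz₀, -⟩ := hz 0
    have hzV : z ∈ t • V := by
      by_contra h
      rw [connectedComponentIn, dif_neg h] at hz₀
      exact hz₀
    have hw : t⁻¹ • z ∈ V := (Set.mem_smul_set_iff_inv_smul_mem₀ ht.ne' V z).1 hzV
    intro Λ
    obtain ⟨z', hz', hΛ⟩ := hz (t * Λ)
    have himg : connectedComponentIn (t • V) z = φ '' connectedComponentIn V (t⁻¹ • z) := by
      rw [hφV, Homeomorph.image_connectedComponentIn φ hw]
      congr 1
      show z = t • (t⁻¹ • z)
      rw [smul_smul, mul_inv_cancel₀ ht.ne', one_smul]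
    rw [himg] at hz'
    obtain ⟨w, hw', rfl⟩ := hz'
    refine ⟨w, hw', ?_⟩
    have h2 : (φ w).2 = t * w.2 := rfl
    rw [h2] at hΛ
    exact le_of_mul_le_mul_left hΛ ht
  · intro hz
    obtain ⟨z₀, hz₀, -⟩ := hz 0
    have hwV : t⁻¹ • z ∈ V := by
      by_contra h
      rw [connectedComponentIn, dif_neg h] at hz₀
      exact hz₀
    intro Λ
    obtain ⟨w, hw, hΛ⟩ := hz (t⁻¹ * Λ)
    have himg : connectedComponentIn (t • V) z = φ '' connectedComponentIn V (t⁻¹ • z) := by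
      rw [hφV, Homeomorph.image_connectedComponentIn φ hwV]
      congr 1
      show z = t • (t⁻¹ • z)
      rw [smul_smul, mul_inv_cancel₀ ht.ne', one_smul]
    refine ⟨φ w, by rw [himg]; exact Set.mem_image_of_mem _ hw, ?_⟩
    show Λ ≤ t * w.2
    have := mul_le_mul_of_nonneg_left hΛ ht.le
    rwa [← mul_assoc, mul_inv_cancel₀ ht.ne', one_mul] at this

omit [DecidableEq d] in
/-- `energy (t • c) = t² energy c`. [folklore] -/
theorem energy_smul (t : ℝ) (c : ↥S → EuclideanSpace ℂ d) : energy (t • c) = t ^ 2 * energy c := by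
  unfold energy
  rw [Finset.mul_sum]
  refine Finset.sum_congr rfl fun k _ => ?_
  rw [Pi.smul_apply, norm_smul, Real.norm_eq_abs, mul_pow, sq_abs]

omit [DecidableEq d] in
/-- `dissipation (tν) (t • c) = t³ dissipation ν c`. [folklore] -/
theorem dissipation_smul (t ν : ℝ) (c : ↥S → EuclideanSpace ℂ d) :
    dissipation (t * ν) (t • c) = t ^ 3 * dissipation ν c := by
  unfold dissipation
  have : ∑ k : ↥S, freqNormSq (k : d → ℤ) * ‖(t • c) k‖ ^ 2 =
      t ^ 2 * ∑ k : ↥S, freqNormSq (k : d → ℤ) * ‖c k‖ ^ 2 := by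
    rw [Finset.mul_sum]
    refine Finset.sum_congr rfl fun k _ => ?_
    rw [Pi.smul_apply, norm_smul, Real.norm_eq_abs, mul_pow, sq_abs]; ring
  rw [this]; ring

omit [DecidableEq d] in
/-- The force vector is linear in the force: `forceCoeff S (t • f) = t • forceCoeff S f`. [folklore] -/
theorem forceCoeff_smul (S : Finset (d → ℤ)) (t : ℝ) (f : UnitAddTorus d → EuclideanSpace ℝ d) :
    forceCoeff S (t • f) = t • forceCoeff S f := by
  funext k
  have h : (EuclideanSpace.complexify ∘ (t • f) : UnitAddTorus d → EuclideanSpace ℂ d) =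
      (t : ℂ) • (EuclideanSpace.complexify ∘ f) := by
    funext x
    show EuclideanSpace.complexify (t • f x) = (t : ℂ) • EuclideanSpace.complexify (f x)
    rw [LinearIsometry.map_smul]
    exact RCLike.real_smul_eq_coe_smul (K := ℂ) t _
  unfold forceCoeff
  rw [h, mFourierCoeff_const_smul, Pi.smul_apply]
  exact (RCLike.real_smul_eq_coe_smul (K := ℂ) t _).symm

/-- **SCALE COVARIANCE OF ADMISSIBILITY** (one direction): if `ν₀` is admissible for `(f, E, ε)` then `t ν₀` is
admissible for `(t² f, t² E, t³ ε)`, `t > 0`. [folklore] -/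
theorem admissible_scale {f : UnitAddTorus (Fin 3) → EuclideanSpace ℝ (Fin 3)} {E ε ν₀ t : ℝ} (ht : 0 < t)
    (h : ν₀ ∈ admissibleSet f E ε) :
    t * ν₀ ∈ admissibleSet ((t ^ 2) • f) (t ^ 2 * E) (t ^ 3 * ε) := by
  intro N z hz hlam hpos hlt hE
  have hV : steadySet (modes (Fin 3) N) (forceCoeff (modes (Fin 3) N) ((t ^ 2) • f)) =
      t • steadySet (modes (Fin 3) N) (forceCoeff (modes (Fin 3) N) f) := by
    rw [forceCoeff_smul, steadySet_scale ht.ne']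
  rw [hV] at hz hlam
  rw [laminarSet_scale _ ht] at hlam
  have hw : t⁻¹ • z ∈ steadySet (modes (Fin 3) N) (forceCoeff (modes (Fin 3) N) f) :=
    (Set.mem_smul_set_iff_inv_smul_mem₀ ht.ne' _ z).1 hz
  have hwl : t⁻¹ • z ∈ laminarSet (steadySet (modes (Fin 3) N) (forceCoeff (modes (Fin 3) N) f)) :=
    (Set.mem_smul_set_iff_inv_smul_mem₀ ht.ne' _ z).1 hlam
  have h2 : (t⁻¹ • z).2 = t⁻¹ * z.2 := rfl
  have h1 : (t⁻¹ • z).1 = t⁻¹ • z.1 := rfl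
  have hti : 0 < t⁻¹ := inv_pos.2 ht
  have hd := h N (t⁻¹ • z) hw hwl (by rw [h2]; positivity)
    (by rw [h2, ← div_eq_inv_mul, div_lt_iff₀ ht, mul_comm]; exact hlt)
    (by rw [h1, energy_smul, inv_pow, ← div_eq_inv_mul, div_le_iff₀ (by positivity), mul_comm]; exact hE)
  have hdiss : dissipation z.2 z.1 = t ^ 3 * dissipation (t⁻¹ • z).2 (t⁻¹ • z).1 := by
    rw [h1, h2, ← dissipation_smul t, smul_smul, mul_inv_cancel₀ ht.ne', one_smul, ← mul_assoc,
      mul_inv_cancel₀ ht.ne', one_mul]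
  rw [hdiss]
  exact mul_lt_mul_of_pos_left hd (by positivity)

/-- **SCALE COVARIANCE OF ADMISSIBILITY**: `ν₀ ∈ admissibleSet f E ε ↔ tν₀ ∈ admissibleSet (t²f) (t²E) (t³ε)`
for `t > 0` — the crux may be normalised (e.g. `‖f‖₂ = 1`); its only scale-free budget is `ε²/(E∫‖f‖²)`. [folklore] -/
theorem admissible_scale_iff {f : UnitAddTorus (Fin 3) → EuclideanSpace ℝ (Fin 3)} {E ε ν₀ t : ℝ} (ht : 0 < t) :
    ν₀ ∈ admissibleSet f E ε ↔ t * ν₀ ∈ admissibleSet ((t ^ 2) • f) (t ^ 2 * E) (t ^ 3 * ε) := by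
  refine ⟨admissible_scale ht, fun h => ?_⟩
  have h' := admissible_scale (inv_pos.2 ht) h
  have e1 : t⁻¹ * (t * ν₀) = ν₀ := by rw [← mul_assoc, inv_mul_cancel₀ ht.ne', one_mul]
  have e2 : (t⁻¹ ^ 2) • ((t ^ 2) • f) = f := by
    rw [smul_smul, inv_pow, inv_mul_cancel₀ (pow_ne_zero 2 ht.ne'), one_smul]
  have e3 : t⁻¹ ^ 2 * (t ^ 2 * E) = E := by
    rw [← mul_assoc, inv_pow, inv_mul_cancel₀ (pow_ne_zero 2 ht.ne'), one_mul]
  have e4 : t⁻¹ ^ 3 * (t ^ 3 * ε) = ε := by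
    rw [← mul_assoc, inv_pow, inv_mul_cancel₀ (pow_ne_zero 3 ht.ne'), one_mul]
  rwa [e1, e2, e3, e4] at h'

end Scaling

end Summit.AnomalousDissipation.AnomalousDissipation.Theorems.LaminarNeverLoud.Negative
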